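import Summits.BirchSwinnertonDyer.BirchSwinnertonDyer.Theorems.ResidualThetaTransportAtTwoThetaLayerLambdaCongruenceAtTwoPeriodFactor
import Summits.BirchSwinnertonDyer.BirchSwinnertonDyer.Theorems.ResidualThetaTransportAtTwoThetaLayerLambdaCongruenceAtTwoCuspCharacterSymbol
import Literature.NumberTheory.EllipticCurves.ModularFormsGamma0Genus
import HarnessLib

/-!
# Crux `ThetaLayerLambdaCongruenceAtTwo` (stmt-BirchSwinnertonDyer-20688, route ResidualThetaTransportAtTwo), line
# `birth` v13 — SD floor at `ℓ = 2`, brick S1: a character of `Γ₀(N)` killing the cusp stabilisers and the order-`4`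
# elliptic elements FACTORS THROUGH THE PERIOD LATTICE `H₁(X₀(N), ℤ) ⊂ S₂(Γ₀(N))^∨`, and conversely (width seat
# bsd-wall-rtt-p3-w2 g8; `--supports stmt-BirchSwinnertonDyer-20688 --as helper`; closes nothing)

HONEST FRAMING. THEOREMS only, about an abstract character `u : Γ₀(N) → R` and the tree's period functionals; the genus formula
enters through the tree's THEOREM `twelve_mul_finrank_cuspForm_two_gamma0_holds`. Nothing about any curve or form is asserted;
BSD is not proved by any of this; Kan⁺ stays conditional on the two print facts SD/Bz of skeleton v13.

WHAT. Let `N ≥ 1`, `R` an additive group without `3`-torsion (e.g. any `𝔽₂`-vector space), and `u : Γ₀(N) → R` with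
(a) `u(γδ) = u(γ) + u(δ)`; (b) `u(γ) = 0` whenever `γ` fixes a cusp, i.e. `(k⁻¹γk)₁₀ = 0` for some `k ∈ SL₂(ℤ)` (this kills `±1`
and every `±`parabolic element); (c) `u(γ) = 0` whenever `γk = kS` for some `k ∈ SL₂(ℤ)` (the order-`4` elliptic elements; if `2`
is invertible in `R` this follows from (a), (b) — NOT for `R` of characteristic `2`). THEN
(`character_sum_eq_zero_of_periodFunctionals_eq_zero`) every integral relation `Σ nᵢ·{∞, γᵢ∞} = 0` among period functionals holds
among the values, `Σ nᵢ·u(γᵢ) = 0`; hence (`exists_addMonoidHom_periodHomology_of_cuspCharacter`) `u = φ ∘ periodFunctional N` for an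
additive `φ : Λ → R`, `Λ = periodHomology N`, and (`character_eq_of_periodFunctional_eq`) `u` is constant on the fibres of
`γ ↦ {∞, γ∞}`. CONVERSELY (§3, `cuspCharacter_of_addMonoidHom_periodHomology`) every `φ ∘ periodFunctional N` satisfies (a)–(c)
(`periodFunctional_eq_zero_of_conj_upper`, `periodFunctional_eq_zero_of_conj_S`). In words: `Hom(Λ, R) ∘ per` IS the group of
`R`-characters of `Γ₀(N)` killing cusp stabilisers and order-`4` elliptic elements — for `R` an `𝔽₂`-space, `Hom(Λ/2Λ, R) =
H¹_par^{ell}(Γ₀(N); R)`: `Λ/2Λ` misses no `2`-torsion of `Γ₀(N)ᵃᵇ/⟨±1, parabolic⟩` beyond the elliptic classes. Over `ℝ` this is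
the tree's `finrank_parabolicCocycles_le_two_mul_finrank` (Shimura (8.2.24)); the torsion-sensitive form is brick S1 of the sign-free
architecture for the consumed `ℓ = 2` instance of `heckeSelfDual_torsionBy_J0` (`Cruxes/…/Lines/birth-sd2-architecture.md`), and it
turns the hypothesis «`χ` factors through the period functionals» of the node `CuspSpanEvenAtTwoOdd` (item 27436) into «`χ` kills
parabolic and order-`4` elliptic elements».

HOW. §1 `periods_eq_zero_of_periodFunctionals_eq_zero_of_ellipticPeriods`: the B1 theorem
`…PeriodFactor.periods_eq_zero_of_periodFunctionals_eq_zero` with its `T₂Φ = 0` / `N` odd hypotheses replaced by what its proof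
uses — the vanishing of the elliptic periods `Φ(δ·∞)`, `δk = kS` (proof otherwise verbatim: universal Manin chains, exactness of
Manin's presentation over `ℚ`, the integral torsion lemma `…ManinSymbolTorsion`). §2: apply §1 to the symbol function `Φ_u` of
`…CuspCharacterSymbol.exists_maninFunction_of_cuspCharacter` (cusp values `u`), then build `φ` on `Λ = {per γ}`
(`coe_periodHomology_eq_range`). §3: Manin's relation at a fixed cusp (`inftySymbol_gamma0_mul`) and `γ⁴ = 1`.

References: [Manin1972] §1.5–1.7, Prop. 1.4, Thm. 1.9; [ShimuraIATAF1971] §8.1–8.2, (8.2.24); [CremonaAlgorithms1997] §2.1–2.2.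
-/

set_option autoImplicit false

noncomputable section

-- justification: the `Summit.BirchSwinnertonDyer.BirchSwinnertonDyer.…` path repeats a component (route-file convention)
set_option linter.dupNamespace false

open scoped Classical MatrixGroups

open CongruenceSubgroup Matrix.SpecialLinearGroup ModularGroup
open Literature.NumberTheory.EllipticCurves.ModularForms

namespace Summit.BirchSwinnertonDyer.BirchSwinnertonDyer.Theorems.ThetaLayerLambdaCongruenceAtTwo

/-! ## §1. B1 without `T₂`: periods factor through the period lattice once the elliptic periods vanish -/

section EllipticPeriods

variable {R : Type} [AddCommGroup R] {N : ℕ} [NeZero N] {Φ : ℚ → R}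

/-- **B1, `T₂`-free form.** `R` without `3`-torsion, `Φ : ℚ → R` a Γ₀(N)-symbol function (Manin's relation) whose ELLIPTIC PERIODS
vanish: `Φ(δ·∞) = 0` whenever `δk = kS` for some `k ∈ SL₂(ℤ)` (then the Manin symbols of `Φ` vanish on the `S`-fixed cosets,
`maninSymbol_eq_neg_maninCusp_of_sigmaFixed`). Then every integral linear relation `Σᵢ nᵢ·{∞, γᵢ∞} = 0` among period functionals
(`γᵢ ∈ Γ₀(N)`) holds among the periods of `Φ`: `Σᵢ nᵢ·Φ(γᵢ·∞) = 0`. The proof is that of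
`periods_eq_zero_of_periodFunctionals_eq_zero` (which derives the elliptic vanishing from `T₂Φ = 0` at odd `N`), with the genus
formula now the tree's theorem `twelve_mul_finrank_cuspForm_two_gamma0_holds`. [cite: Manin1972, Thm. 1.9] -/
theorem periods_eq_zero_of_periodFunctionals_eq_zero_of_ellipticPeriods
    (hM : ∀ (γ : Gamma0 N) (r : ℚ), ((γ : SL(2, ℤ)) 1 0 : ℚ) * r + ((γ : SL(2, ℤ)) 1 1 : ℚ) ≠ 0 →
      Φ ((((γ : SL(2, ℤ)) 0 0 : ℚ) * r + ((γ : SL(2, ℤ)) 0 1 : ℚ)) /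
        (((γ : SL(2, ℤ)) 1 0 : ℚ) * r + ((γ : SL(2, ℤ)) 1 1 : ℚ))) =
        (if ((γ : SL(2, ℤ)) 1 0) = 0 then 0 else Φ ((((γ : SL(2, ℤ)) 0 0 : ℚ)) / (((γ : SL(2, ℤ)) 1 0 : ℚ)))) + Φ r)
    (hell : ∀ (δ : Gamma0 N) (k : SL(2, ℤ)), (δ : SL(2, ℤ)) * k = k * S →
      (if ((δ : SL(2, ℤ)) 1 0) = 0 then (0 : R) else Φ ((((δ : SL(2, ℤ)) 0 0 : ℚ)) / (((δ : SL(2, ℤ)) 1 0 : ℚ)))) = 0)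
    (h3 : ∀ r : R, r + r + r = 0 → r = 0)
    {ι : Type} [Fintype ι] (n : ι → ℤ) (γ : ι → Gamma0 N)
    (hrel : ∑ i, n i • periodFunctional N (γ i) = 0) :
    ∑ i, n i • (if (((γ i : Gamma0 N) : SL(2, ℤ)) 1 0) = 0 then 0 else Φ (((((γ i : Gamma0 N) : SL(2, ℤ)) 0 0 : ℚ)) / ((((γ i : Gamma0 N) : SL(2, ℤ)) 1 0 : ℚ)))) = 0 := by
  have hgenus : twelve_mul_finrank_cuspForm_two (Gamma0 N) := twelve_mul_finrank_cuspForm_two_gamma0_holds N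
  -- the Manin-symbol system of `Φ` on `SL₂(ℤ)` and its properties (landed files)
  set MS : SL(2, ℤ) → R := fun h ↦ (if (h 1 0) = 0 then 0 else Φ (((h 0 0 : ℚ)) / ((h 1 0 : ℚ)))) - (if ((h * S) 1 0) = 0 then 0 else Φ ((((h * S) 0 0 : ℚ)) / (((h * S) 1 0 : ℚ)))) with hMS
  have hinv : ∀ (δ : Gamma0 N) (h : SL(2, ℤ)), MS ((δ : SL(2, ℤ)) * h) = MS h := fun δ h ↦ by
    simp only [hMS]; exact maninSymbol_gamma0_mul hM δ h
  have hnegMS : ∀ h, MS (-h) = MS h := fun h ↦ by simp only [hMS]; exact maninSymbol_neg Φ h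
  have hSMS : ∀ h, MS (h * S) = -MS h := fun h ↦ by
    have := maninSymbol_two_term Φ h
    simp only [hMS]
    exact eq_neg_of_add_eq_zero_right this
  have hτm : (S * T⁻¹ : SL(2, ℤ)) = ⟨!![0, -1; 1, -1], by norm_num [Matrix.det_fin_two_of]⟩ := by
    apply Subtype.ext
    rw [coe_mul, coe_S, coe_T_inv]
    ext i j
    fin_cases i <;> fin_cases j <;> simp [Matrix.mul_apply, Fin.sum_univ_two]
  have h3t : ∀ h, MS h + MS (h * (S * T⁻¹)) + MS (h * (S * T⁻¹) * (S * T⁻¹)) = 0 := fun h ↦ by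
    have := maninSymbol_three_term Φ h
    simp only [hMS]
    rw [hτm]
    exact this
  have hσ : ∀ (δ : Gamma0 N) (h : SL(2, ℤ)), (δ : SL(2, ℤ)) * h = h * S → MS h = 0 := fun δ h hfix ↦ by
    simp only [hMS]
    rw [maninSymbol_eq_neg_maninCusp_of_sigmaFixed hM δ h hfix, hell δ h hfix, neg_zero]
  have hτ0 : ∀ (δ : Gamma0 N) (h : SL(2, ℤ)), (δ : SL(2, ℤ)) * h = h * (S * T⁻¹) → MS h = 0 :=
    fun δ h hfix ↦ apply_eq_zero_of_tau_fixed MS hinv h3t h3 δ h hfix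
  -- the system on the coset space `X`
  set M : Gamma0Coset N → R := fun q ↦ MS (q.out)⁻¹ with hMdef
  have hM1 : ∀ q, M (S • q) = -M q := fun q ↦ cosetSystem_S MS hinv hnegMS hSMS q
  have hM2 : ∀ q, M q + M ((T * S) • q) + M ((T * S) • (T * S) • q) = 0 := fun q ↦
    cosetSystem_TS MS hinv hnegMS h3t q
  have hM3 : ∀ q, S • q = q → M q = 0 := fun q hq ↦ cosetSystem_S_fixed MS hinv hσ q hq
  have hM4 : ∀ q, (T * S) • q = q → M q = 0 := fun q hq ↦ cosetSystem_TS_fixed MS hinv hτ0 q hq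
  -- universal chains for the `γ i`
  choose L hL using fun i ↦ exists_maninChain.{0} ((γ i : Gamma0 N) : SL(2, ℤ))
  -- the integral chain `cZ = Σ nᵢ · chainVec (L i)` and its pairing identity
  set cZ : Gamma0Coset N → ℤ := fun q ↦
    ∑ i, n i * ((L i).map fun g ↦ (Pi.single ((g⁻¹ : SL(2, ℤ)) : Gamma0Coset N) (1 : ℤ) : Gamma0Coset N → ℤ)).sum q
    with hcZ
  have pair : ∀ {V : Type} [AddCommGroup V] (v : Gamma0Coset N → V),
      ∑ q, cZ q • v q = ∑ i, n i • ((L i).map fun g ↦ v ((g⁻¹ : SL(2, ℤ)) : Gamma0Coset N)).sum := by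
    intro V _ v
    simp only [hcZ, Finset.sum_smul, mul_smul]
    rw [Finset.sum_comm]
    refine Finset.sum_congr rfl fun i _ ↦ ?_
    rw [← sum_chainVec_smul v (L i), Finset.smul_sum]
  -- the rational chain `c`
  set c : Gamma0Coset N → ℚ := fun q ↦ (cZ q : ℚ) with hc
  have pairQ : ∀ {V : Type} [AddCommGroup V] [Module ℚ V] (v : Gamma0Coset N → V),
      ∑ q, c q • v q = ∑ i, n i • ((L i).map fun g ↦ v ((g⁻¹ : SL(2, ℤ)) : Gamma0Coset N)).sum := by
    intro V _ _ v
    rw [← pair v]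
    exact Finset.sum_congr rfl fun q _ ↦ Int.cast_smul_eq_zsmul ℚ (cZ q) (v q)
  -- `Ψ(c) = Σ nᵢ {∞, γᵢ∞} = 0`
  have hΨ : msymbolMap N c = 0 := by
    have e : msymbolMap N c = ∑ q, c q • msymbol N q := by
      rw [msymbolMap, Fintype.linearCombination_apply]
    rw [e, pairQ (msymbol N)]
    have e3 : ∀ i, ((L i).map fun g ↦ msymbol N ((g⁻¹ : SL(2, ℤ)) : Gamma0Coset N)).sum =
        periodFunctional N (γ i) := fun i ↦ by
      rw [periodFunctional_eq_inftyFunctional, ← maninChain_sum_msymbolFunctional (hL i)]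
      congr 1
      refine List.map_congr_left fun g _ ↦ ?_
      rw [msymbol_mk, inv_inv]
    simp_rw [e3]
    exact hrel
  -- `δ(c) = Σ nᵢ ([γᵢ∞] − [∞]) = 0`
  have hδ : bdryMap N c = 0 := by
    have e : bdryMap N c = ∑ q, c q • bdryVec N q := by
      rw [bdryMap, Fintype.linearCombination_apply]
    rw [e, pairQ (bdryVec N)]
    have e3 : ∀ i, ((L i).map fun g ↦ bdryVec N ((g⁻¹ : SL(2, ℤ)) : Gamma0Coset N)).sum = 0 := fun i ↦ by
      have hb : ∀ g : SL(2, ℤ), bdryVec N ((g⁻¹ : SL(2, ℤ)) : Gamma0Coset N) =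
          Pi.single (cuspOrbitOf N g) (1 : ℚ) - Pi.single (cuspOrbitOf N (g * S)) 1 := fun g ↦ by
        rw [bdryVec, cuspInfty_mk, inv_inv, MulAction.Quotient.smul_mk, smul_eq_mul, cuspInfty_mk, mul_inv_rev,
          inv_inv, inv_inv]
      simp_rw [hb]
      rw [maninChain_sum_cuspOrbitOf (hL i), ← mul_one ((γ i : Gamma0 N) : SL(2, ℤ)),
        cuspOrbitOf_mul_of_mem (γ i).2, sub_self]
    simp_rw [e3, smul_zero, Finset.sum_const_zero]
  -- exactness over `ℚ`: `c ∈ Rel`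
  have hcRel : c ∈ relModule N := by
    rw [← ker_msymbolMap_inf_ker_bdryMap_eq_relModule N hgenus]
    exact ⟨LinearMap.mem_ker.mpr hΨ, LinearMap.mem_ker.mpr hδ⟩
  obtain ⟨y, hy, z, hz, hyz⟩ := Submodule.mem_sup.mp hcRel
  obtain ⟨u, rfl⟩ := LinearMap.mem_range.mp hy
  obtain ⟨v, rfl⟩ := LinearMap.mem_range.mp hz
  -- clear denominators
  set D : ℕ := ∏ q, ((u q).den * (v q).den) with hD
  have hD0 : D ≠ 0 := Finset.prod_ne_zero_iff.mpr fun q _ ↦ mul_ne_zero (u q).den_nz (v q).den_nz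
  have hdu : ∀ q, (u q).den ∣ D := fun q ↦
    (Dvd.intro _ rfl : (u q).den ∣ (u q).den * (v q).den).trans (Finset.dvd_prod_of_mem _ (Finset.mem_univ q))
  have hdv : ∀ q, (v q).den ∣ D := fun q ↦
    (Dvd.intro_left _ rfl : (v q).den ∣ (u q).den * (v q).den).trans (Finset.dvd_prod_of_mem _ (Finset.mem_univ q))
  choose uZ huZ using fun q ↦ exists_int_cast_eq_natCast_mul (u q) D (hdu q)
  choose vZ hvZ using fun q ↦ exists_int_cast_eq_natCast_mul (v q) D (hdv q)
  have hSS : ∀ q : Gamma0Coset N, S • S • q = q := fun q ↦ by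
    rw [← mul_smul, S_mul_S_eq_neg_one, neg_one_smul_coset]
  have hTS3 : ∀ q : Gamma0Coset N, (T * S) • (T * S) • (T * S) • q = q := fun q ↦ by
    rw [← mul_smul, ← mul_smul, TS_pow_three_eq, neg_one_smul_coset]
  set AZ : Gamma0Coset N → ℤ := fun q ↦ uZ q + uZ (S • q) with hAZ'
  set BZ : Gamma0Coset N → ℤ := fun q ↦ vZ q + vZ ((T * S) • q) + vZ ((T * S) • (T * S) • q) with hBZ'
  have hAZ : ∀ q, AZ (S • q) = AZ q := fun q ↦ by
    show uZ (S • q) + uZ (S • S • q) = uZ q + uZ (S • q)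
    rw [hSS, add_comm]
  have hBZ : ∀ q, BZ ((T * S) • q) = BZ q := fun q ↦ by
    show vZ ((T * S) • q) + vZ ((T * S) • (T * S) • q) + vZ ((T * S) • (T * S) • (T * S) • q) =
      vZ q + vZ ((T * S) • q) + vZ ((T * S) • (T * S) • q)
    rw [hTS3]; abel
  have hrelZ : ∀ q, (D : ℤ) * cZ q = AZ q + BZ q + 0 := fun q ↦ by
    have e := congrFun hyz q
    have e' : c q = (u q + u (S • q)) + (v q + v ((T * S) • q) + v ((T * S) • (T * S) • q)) := by
      rw [← e]
      simp only [relTwo, relThree, Pi.add_apply, LinearMap.add_apply, LinearMap.id_apply, LinearMap.comp_apply,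
        cosetPerm_apply]
    apply Int.cast_injective (α := ℚ)
    rw [add_zero]
    push_cast
    rw [show ((cZ q : ℤ) : ℚ) = c q from rfl, e', show ((AZ q : ℤ) : ℚ) = (uZ q : ℚ) + (uZ (S • q) : ℚ) by
      simp only [hAZ']; push_cast; rfl, show ((BZ q : ℤ) : ℚ) = (vZ q : ℚ) + (vZ ((T * S) • q) : ℚ) +
      (vZ ((T * S) • (T * S) • q) : ℚ) by simp only [hBZ']; push_cast; rfl, huZ, huZ, hvZ, hvZ, hvZ]
    ring
  -- the torsion lemma
  have key := sum_smul_eq_zero_of_mul_eq_relation (X := Gamma0Coset N) (fun q ↦ S • q) (fun q ↦ (T * S) • q)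
    hSS hTS3 M hM1 hM2 hM3 hM4 h3 cZ AZ BZ (fun _ ↦ 0) (D : ℤ) (by exact_mod_cast hD0) hAZ hBZ
    (fun q h ↦ (h rfl).elim) hrelZ
  rw [pair M] at key
  have e4 : ∀ i, ((L i).map fun g ↦ M ((g⁻¹ : SL(2, ℤ)) : Gamma0Coset N)).sum =
      (if (((γ i : Gamma0 N) : SL(2, ℤ)) 1 0) = 0 then 0 else Φ (((((γ i : Gamma0 N) : SL(2, ℤ)) 0 0 : ℚ)) / ((((γ i : Gamma0 N) : SL(2, ℤ)) 1 0 : ℚ)))) := fun i ↦ by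
    rw [← maninChain_sum_maninSymbol Φ (hL i)]
    congr 1
    refine List.map_congr_left fun g _ ↦ ?_
    show MS ((((g⁻¹ : SL(2, ℤ)) : Gamma0Coset N)).out)⁻¹ = _
    rw [apply_out_inv_mk MS hinv, inv_inv]
  simp_rw [e4] at key
  exact key

end EllipticPeriods

/-! ## §2. Assembly: characters killing cusp stabilisers and order-`4` elliptic elements factor through `Λ` -/

section Factor

variable {R : Type} [AddCommGroup R] {N : ℕ} [NeZero N]

/-- **Relations among period functionals hold among the values of a cusp-elliptic character.** `R` without `3`-torsion;
`u : Γ₀(N) → R` additive, vanishing on the stabiliser of every cusp (`(k⁻¹γk)₁₀ = 0 ⇒ u γ = 0`) and on the order-`4` elliptic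
elements (`γk = kS ⇒ u γ = 0`). Then `Σ nᵢ·{∞, γᵢ∞} = 0` in `S₂(Γ₀(N))^∨` implies `Σ nᵢ·u(γᵢ) = 0`. (§2 makes `u` the period
homomorphism of a symbol function whose elliptic periods vanish; §1 applies.) [cite: Manin1972, Thm. 1.9]
[cite: ShimuraIATAF1971, §8.2 (8.2.24)] -/
theorem character_sum_eq_zero_of_periodFunctionals_eq_zero (u : Gamma0 N → R)
    (hadd : ∀ γ δ : Gamma0 N, u (γ * δ) = u γ + u δ)
    (hstab : ∀ (γ : Gamma0 N) (k : SL(2, ℤ)), (k⁻¹ * (γ : SL(2, ℤ)) * k) 1 0 = 0 → u γ = 0)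
    (hell : ∀ (γ : Gamma0 N) (k : SL(2, ℤ)), (γ : SL(2, ℤ)) * k = k * S → u γ = 0)
    (h3 : ∀ r : R, r + r + r = 0 → r = 0)
    {ι : Type} [Fintype ι] (n : ι → ℤ) (γ : ι → Gamma0 N)
    (hrel : ∑ i, n i • periodFunctional N (γ i) = 0) :
    ∑ i, n i • u (γ i) = 0 := by
  obtain ⟨Φ, hM, hcusp⟩ := exists_maninFunction_of_cuspCharacter u hadd hstab
  have hellΦ : ∀ (δ : Gamma0 N) (k : SL(2, ℤ)), (δ : SL(2, ℤ)) * k = k * S →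
      (if ((δ : SL(2, ℤ)) 1 0) = 0 then (0 : R) else Φ ((((δ : SL(2, ℤ)) 0 0 : ℚ)) / (((δ : SL(2, ℤ)) 1 0 : ℚ)))) = 0 :=
    fun δ k h ↦ by rw [hcusp]; exact hell δ k h
  have key := periods_eq_zero_of_periodFunctionals_eq_zero_of_ellipticPeriods hM hellΦ h3 n γ hrel
  simp_rw [hcusp] at key
  exact key

/-- **A cusp-elliptic character is constant on the fibres of the period map** `γ ↦ {∞, γ∞}`: if
`{∞, γ∞} = {∞, δ∞}` in `S₂(Γ₀(N))^∨` then `u γ = u δ`. This is the hypothesis «`χ` factors through the period functionals» of the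
node `CuspSpanEvenAtTwoOdd` (item 27436), DERIVED from «`χ` kills parabolic and order-`4` elliptic elements». [cite: Manin1972, Thm. 1.9] -/
theorem character_eq_of_periodFunctional_eq (u : Gamma0 N → R)
    (hadd : ∀ γ δ : Gamma0 N, u (γ * δ) = u γ + u δ)
    (hstab : ∀ (γ : Gamma0 N) (k : SL(2, ℤ)), (k⁻¹ * (γ : SL(2, ℤ)) * k) 1 0 = 0 → u γ = 0)
    (hell : ∀ (γ : Gamma0 N) (k : SL(2, ℤ)), (γ : SL(2, ℤ)) * k = k * S → u γ = 0)
    (h3 : ∀ r : R, r + r + r = 0 → r = 0)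
    (γ δ : Gamma0 N) (h : periodFunctional N γ = periodFunctional N δ) : u γ = u δ := by
  have hrel : ∑ i : Fin 2, (![1, -1] i) • periodFunctional N (![γ, δ] i) = 0 := by
    rw [Fin.sum_univ_two]
    simp [h]
  have key := character_sum_eq_zero_of_periodFunctionals_eq_zero u hadd hstab hell h3 _ _ hrel
  rw [Fin.sum_univ_two] at key
  simp only [Matrix.cons_val_zero, Matrix.cons_val_one, one_smul, neg_smul] at key
  exact sub_eq_zero.mp (by rw [sub_eq_add_neg]; exact key)

/-- **Factorisation through the period lattice** `Λ = H₁(X₀(N), ℤ) ⊂ S₂(Γ₀(N))^∨`: a character `u : Γ₀(N) → R` (`R` without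
`3`-torsion) vanishing on the cusp stabilisers and on the order-`4` elliptic elements is `φ ∘ (γ ↦ {∞, γ∞})` for an additive
`φ : Λ → R`. With `R` an `𝔽₂`-vector space: `Hom(Λ/2Λ, R)` = the parabolic, elliptic-killing `R`-characters of `Γ₀(N)` — the
`2`-torsion form of the Eichler–Shimura count `dim H¹_P(Γ₀(N), ℝ) = 2g` (`finrank_parabolicCocycles_eq_holds`).
[cite: ShimuraIATAF1971, §8.2 (8.2.24)] [cite: Manin1972, Thm. 1.9] -/
theorem exists_addMonoidHom_periodHomology_of_cuspCharacter (u : Gamma0 N → R)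
    (hadd : ∀ γ δ : Gamma0 N, u (γ * δ) = u γ + u δ)
    (hstab : ∀ (γ : Gamma0 N) (k : SL(2, ℤ)), (k⁻¹ * (γ : SL(2, ℤ)) * k) 1 0 = 0 → u γ = 0)
    (hell : ∀ (γ : Gamma0 N) (k : SL(2, ℤ)), (γ : SL(2, ℤ)) * k = k * S → u γ = 0)
    (h3 : ∀ r : R, r + r + r = 0 → r = 0) :
    ∃ φ : periodHomology N →+ R, ∀ γ : Gamma0 N,
      φ ⟨periodFunctional N γ, periodFunctional_mem_periodHomology N γ⟩ = u γ := by
  have hwd := character_eq_of_periodFunctional_eq u hadd hstab hell h3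
  -- every element of `Λ` is a single period functional
  have hsurj : ∀ x : periodHomology N, ∃ γ : Gamma0 N, periodFunctional N γ = (x : Module.Dual ℂ (CuspForm (Gamma0 N) 2)) :=
    fun x ↦ by
      have hx : (x : Module.Dual ℂ (CuspForm (Gamma0 N) 2)) ∈ (periodHomology N : Set (Module.Dual ℂ (CuspForm (Gamma0 N) 2))) :=
        x.2
      rw [coe_periodHomology_eq_range] at hx
      exact hx
  choose sec hsec using hsurj
  have hu1 : u 1 = 0 := by
    have h := hadd 1 1
    rw [one_mul] at h
    exact left_eq_add.mp h
  refine ⟨{ toFun := fun x ↦ u (sec x), map_zero' := ?_, map_add' := ?_ }, ?_⟩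
  · show u (sec 0) = 0
    rw [hwd (sec 0) 1 (by rw [hsec, periodFunctional_one]; rfl), hu1]
  · intro x y
    show u (sec (x + y)) = u (sec x) + u (sec y)
    rw [← hadd]
    refine hwd _ _ ?_
    rw [periodFunctional_mul, hsec, hsec, hsec]
    rfl
  · intro γ
    show u (sec _) = u γ
    exact hwd _ _ (by rw [hsec])

end Factor

/-! ## §3. The converse: characters that factor through `Λ` kill cusp stabilisers and order-`4` elliptic elements -/

section Converse

variable {R : Type} [AddCommGroup R] {N : ℕ} [NeZero N]

/-- **Period functionals of cusp stabilisers vanish**: if `γ ∈ Γ₀(N)` fixes the cusp `k·∞` (`(k⁻¹γk)₁₀ = 0`), then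
`{∞, γ∞} = 0` in `S₂(Γ₀(N))^∨` (Manin's relation at `k·∞`: `{∞, γk∞} = {∞, γ∞} + {∞, k∞}` and `γk∞ = k∞`). [cite: Manin1972, §1.5 and Prop. 1.4] -/
theorem periodFunctional_eq_zero_of_conj_upper (γ : Gamma0 N) (k : SL(2, ℤ))
    (h : (k⁻¹ * (γ : SL(2, ℤ)) * k) 1 0 = 0) : periodFunctional N γ = 0 := by
  set β : SL(2, ℤ) := k⁻¹ * (γ : SL(2, ℤ)) * k with hβ
  have hγk : (γ : SL(2, ℤ)) * k = k * β := by rw [hβ]; group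
  -- `β₀₀ = ±1`
  have hdet : β 0 0 * β 1 1 = 1 := by
    have hd := Matrix.det_fin_two β.1
    rw [β.2] at hd
    have : β 0 1 * β 1 0 = 0 := by rw [show β 1 0 = 0 from h, mul_zero]
    linear_combination -hd + this
  have hε : β 0 0 = 1 ∨ β 0 0 = -1 := Int.eq_one_or_neg_one_of_mul_eq_one hdet
  -- first column of `kβ` is `β₀₀ ·` first column of `k`
  have e00 : (k * β) 0 0 = β 0 0 * k 0 0 := by
    have e := (Matrix.two_mul_expl (k : Matrix (Fin 2) (Fin 2) ℤ) (β : Matrix (Fin 2) (Fin 2) ℤ)).1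
    rw [Matrix.SpecialLinearGroup.coe_mul, e, show (β : Matrix (Fin 2) (Fin 2) ℤ) 1 0 = 0 from h]; ring
  have e10 : (k * β) 1 0 = β 0 0 * k 1 0 := by
    have e := (Matrix.two_mul_expl (k : Matrix (Fin 2) (Fin 2) ℤ) (β : Matrix (Fin 2) (Fin 2) ℤ)).2.2.1
    rw [Matrix.SpecialLinearGroup.coe_mul, e, show (β : Matrix (Fin 2) (Fin 2) ℤ) 1 0 = 0 from h]; ring
  ext f
  have h1 := inftySymbol_gamma0_mul f γ k
  rw [hγk, inftySymbol_eq_of_apply_eq f (β 0 0) hε e00 e10] at h1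
  rw [periodFunctional_apply, LinearMap.zero_apply]
  have h2 : cuspSymbol f γ + inftySymbol f k = 0 + inftySymbol f k := by rw [zero_add]; exact h1.symm
  exact add_right_cancel h2

/-- **Period functionals of order-`4` elliptic elements vanish**: if `γk = kS` then `γ⁴ = 1`, so `4·{∞, γ∞} = {∞, γ⁴∞} = 0`
and `{∞, γ∞} = 0` in the complex vector space `S₂(Γ₀(N))^∨`. [cite: Manin1972, Prop. 1.4] -/
theorem periodFunctional_eq_zero_of_conj_S (γ : Gamma0 N) (k : SL(2, ℤ))
    (h : (γ : SL(2, ℤ)) * k = k * S) : periodFunctional N γ = 0 := by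
  have hγ : (γ : SL(2, ℤ)) = k * S * k⁻¹ := by rw [← h, mul_inv_cancel_right]
  have h4 : γ * γ * γ * γ = 1 := by
    apply Subtype.ext
    rw [Subgroup.coe_mul, Subgroup.coe_mul, Subgroup.coe_mul, hγ, OneMemClass.coe_one]
    have e : k * S * k⁻¹ * (k * S * k⁻¹) * (k * S * k⁻¹) * (k * S * k⁻¹) = k * ((S * S) * (S * S)) * k⁻¹ := by group
    rw [e, S_mul_S_eq_neg_one, neg_mul_neg, one_mul, mul_one, mul_inv_cancel]
  have hsum : periodFunctional N (γ * γ * γ * γ) = (4 : ℂ) • periodFunctional N γ := by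
    rw [periodFunctional_mul, periodFunctional_mul, periodFunctional_mul]
    rw [show (4 : ℂ) = 1 + 1 + 1 + 1 by norm_num, add_smul, add_smul, add_smul, one_smul]
  rw [h4, periodFunctional_one] at hsum
  exact (smul_eq_zero.mp hsum.symm).resolve_left (by norm_num)

/-- **Converse of `exists_addMonoidHom_periodHomology_of_cuspCharacter`**: a character of the form `φ ∘ (γ ↦ {∞, γ∞})`,
`φ : Λ → R` additive, is additive and kills the cusp stabilisers and the order-`4` elliptic elements. Together:
`Hom(Λ, R) ∘ per` IS the set of such characters (`R` without `3`-torsion). [cite: Manin1972, Prop. 1.4 and Thm. 1.9] -/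
theorem cuspCharacter_of_addMonoidHom_periodHomology (φ : periodHomology N →+ R) :
    (∀ γ δ : Gamma0 N,
        φ ⟨periodFunctional N (γ * δ), periodFunctional_mem_periodHomology N (γ * δ)⟩ =
          φ ⟨periodFunctional N γ, periodFunctional_mem_periodHomology N γ⟩ +
            φ ⟨periodFunctional N δ, periodFunctional_mem_periodHomology N δ⟩) ∧
      (∀ (γ : Gamma0 N) (k : SL(2, ℤ)), (k⁻¹ * (γ : SL(2, ℤ)) * k) 1 0 = 0 →
        φ ⟨periodFunctional N γ, periodFunctional_mem_periodHomology N γ⟩ = 0) ∧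
      (∀ (γ : Gamma0 N) (k : SL(2, ℤ)), (γ : SL(2, ℤ)) * k = k * S →
        φ ⟨periodFunctional N γ, periodFunctional_mem_periodHomology N γ⟩ = 0) := by
  refine ⟨fun γ δ ↦ ?_, fun γ k h ↦ ?_, fun γ k h ↦ ?_⟩
  · rw [← map_add]
    congr 1
    apply Subtype.ext
    simp [periodFunctional_mul]
  · have h0 := periodFunctional_eq_zero_of_conj_upper γ k h
    have : (⟨periodFunctional N γ, periodFunctional_mem_periodHomology N γ⟩ : periodHomology N) = 0 :=
      Subtype.ext h0
    rw [this, map_zero]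
  · have h0 := periodFunctional_eq_zero_of_conj_S γ k h
    have : (⟨periodFunctional N γ, periodFunctional_mem_periodHomology N γ⟩ : periodHomology N) = 0 :=
      Subtype.ext h0
    rw [this, map_zero]

end Converse




end Summit.BirchSwinnertonDyer.BirchSwinnertonDyer.Theorems.ThetaLayerLambdaCongruenceAtTwo

end
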